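import Mathlib
import Literature.Combinatorics.SimpleGraph.FractionalCliqueDecomposition
import Summits.PneNP.PneNP.Theorems.ConvexRankGatesConvexGateBlindCatchTwo

/-!
# PneNP / ConvexRankGates — `ConvexGateBlind`: the ℓ₁-constant is `O(k)`, conditionally on Montgomery's theorem

Helpers (`--supports stmt-PneNP-10680`), COLUMN-SPACE line (prover seat 2, session 16).

THEOREM (`abs_sum_le_linear_of_montgomery`, stub `l1_constant_le_of_montgomery`; CONDITIONAL on the named fact
`Literature.Combinatorics.SimpleGraph.MontgomeryFractionalCliqueDecomposition` = Montgomery 2019, Thm 1.3). Assume: for `r ≥ 4`, every graph with minimum degree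
`≥ (1 − 1/(100r))·n` has a fractional `K_r`-decomposition. Then for `4 ≤ k` and `400k ≤ m`, every `k`-clique-non-negative edge
weighting `w` of `K_m` satisfies

  `∑_e |w(e)| ≤ (400k − 1) · ∑_e w(e)`      (the tree's unconditional constant is `2k² − 4k + 1`, `…CliqueNonnegL1`).

PROOF (duality). Let `B = {w ≥ 0}`. Colour the edges of `K_m` properly by `e = {x,y} ↦ (x + y) mod m` and split `B` into
`t = 200k` classes `B_i` by the colour mod `t`; each `B_i` has maximum degree `≤ m/t + 1`, so `G_i = K_m − B_i` has minimum degree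
`≥ (1 − 1/(100k))m` and a fractional `K_k`-decomposition `ω_i`; pairing `ω_i` with clique-non-negativity gives `w(E ∖ B_i) ≥ 0`.
Summing over `i`: `t·w(E) − w(B) ≥ 0`, i.e. the negative mass is `≤ (1 − 1/t)` times the positive mass, whence
`‖w‖₁ ≤ (2t − 1)·w(E)`. With `…L1LowerBound.l1_constant_ge` (`‖w‖₁ > (k−1)w(E)` is attained) this identifies the
ℓ₁-constant as `Θ(k)` = the inverse fractional-`K_k`-decomposition threshold; in the catch bound of `…CatchTwo` it turns the first
term into `exp(−Ω(m/k³))`, i.e. the column-space LP slice for every `δ < 1/3` conditionally on Montgomery's theorem. [new]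
-/

set_option linter.dupNamespace false

namespace Summit.PneNP.PneNP.Theorems

open Finset Real Literature.Computability.Complexity
open Summit.PneNP.PneNP.Cruxes.ConvexGateBlind.StrictRankConicCover (Edge)
open Literature.Combinatorics.SimpleGraph (MontgomeryFractionalCliqueDecomposition)

noncomputable section

variable {m : ℕ}

/-! ## Residues in a range -/

/-- The number of `c < m` in a fixed residue class mod `t` (`0 < t`) is at most `m / t + 1`. [folklore] -/
theorem card_filter_range_mod_le {t : ℕ} (i : ℕ) :
    ((Finset.range m).filter (fun c => c % t = i)).card ≤ m / t + 1 := by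
  calc ((Finset.range m).filter (fun c => c % t = i)).card
      ≤ (Finset.range (m / t + 1)).card := by
        refine Finset.card_le_card_of_injOn (fun c => c / t) (fun c hc => ?_) (fun c₁ hc₁ c₂ hc₂ h => ?_)
        · rw [Finset.mem_coe, Finset.mem_filter, Finset.mem_range] at hc
          rw [Finset.mem_coe, Finset.mem_range]
          exact Nat.lt_succ_of_le (Nat.div_le_div_right hc.1.le)
        · rw [Finset.mem_coe, Finset.mem_filter] at hc₁ hc₂
          have h1 := Nat.div_add_mod c₁ t
          have h2 := Nat.div_add_mod c₂ t
          have h' : c₁ / t = c₂ / t := h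
          rw [hc₁.2, h'] at h1
          rw [hc₂.2] at h2
          omega
    _ = m / t + 1 := Finset.card_range _

/-! ## The conditional linear ℓ₁-bound (matrix form) -/

/-- **Linear ℓ₁-domination from fractional clique decompositions (matrix form).** Assume
`MontgomeryFractionalCliqueDecomposition`. Let `4 ≤ k`, `400k ≤ m`, and let `V` be symmetric, zero-diagonal and
`k`-clique-non-negative. Then `∑∑ |V| ≤ (400k − 1)·∑∑ V`. [new] -/
theorem sum_sum_abs_le_of_montgomery (hM : MontgomeryFractionalCliqueDecomposition) {k : ℕ} (hk : 4 ≤ k)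
    (hm : 400 * k ≤ m) (V : Fin m → Fin m → ℝ) (hV : ∀ x y, V x y = V y x) (hV0 : ∀ x, V x x = 0)
    (hvalid : ∀ Q ∈ (Finset.univ : Finset (Fin m)).powersetCard k, 0 ≤ ∑ x ∈ Q, ∑ y ∈ Q, V x y) :
    ∑ x, ∑ y, |V x y| ≤ (400 * (k : ℝ) - 1) * ∑ x, ∑ y, V x y := by
  classical
  have hk0 : 0 < k := by omega
  set t : ℕ := 200 * k with htdef
  have ht0 : 0 < t := by rw [htdef]; omega
  have hm0 : 0 < m := by omega
  have hkR : (4 : ℝ) ≤ k := by exact_mod_cast hk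
  have hmR : 400 * (k : ℝ) ≤ m := by exact_mod_cast hm
  have htR : (t : ℝ) = 200 * k := by rw [htdef]; push_cast; ring
  -- the colour of an ordered pair and the classes
  set col : Fin m → Fin m → ℕ := fun x y => ((x : ℕ) + (y : ℕ)) % m with hcol
  have hcol_symm : ∀ x y, col x y = col y x := fun x y => by simp only [hcol, add_comm]
  set Bad : ℕ → Fin m → Fin m → Prop := fun i x y => 0 ≤ V x y ∧ col x y % t = i with hBad
  have hBad_symm : ∀ i x y, Bad i x y → Bad i y x := by
    intro i x y h; simp only [hBad] at h ⊢; rw [hV y x, hcol_symm y x]; exact h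
  -- the graphs `G_i = K_m − B_i`
  set G : ℕ → SimpleGraph (Fin m) := fun i =>
    { Adj := fun x y => x ≠ y ∧ ¬ Bad i x y
      symm := ⟨fun x y h => ⟨Ne.symm h.1, fun hb => h.2 (hBad_symm i y x hb)⟩⟩
      loopless := ⟨fun x h => h.1 rfl⟩ } with hG
  have hGadj : ∀ i x y, (G i).Adj x y ↔ x ≠ y ∧ ¬ Bad i x y := fun i x y => Iff.rfl
  -- degree bound: the bad neighbours of `x` in class `i` inject into a residue class of `range m`
  have hbadcard : ∀ i (x : Fin m), (((Finset.univ : Finset (Fin m)).filter (fun y => x ≠ y ∧ Bad i x y)).card : ℝ) ≤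
      (m : ℝ) / t + 1 := by
    intro i x
    have h1 : ((Finset.univ : Finset (Fin m)).filter (fun y => x ≠ y ∧ Bad i x y)).card ≤
        ((Finset.range m).filter (fun c => c % t = i)).card := by
      refine Finset.card_le_card_of_injOn (fun y => col x y) (fun y hy => ?_) (fun y₁ hy₁ y₂ hy₂ h => ?_)
      · rw [Finset.mem_coe, Finset.mem_filter] at hy
        rw [Finset.mem_coe, Finset.mem_filter, Finset.mem_range]
        exact ⟨Nat.mod_lt _ hm0, hy.2.2.2⟩
      · -- `(x + y₁) % m = (x + y₂) % m` with `y₁, y₂ < m` forces `y₁ = y₂`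
        simp only [hcol] at h
        apply Fin.ext
        have hy1 := y₁.isLt
        have hy2 := y₂.isLt
        have := Nat.ModEq.add_left_cancel' (x : ℕ) (show Nat.ModEq m ((x : ℕ) + y₁) ((x : ℕ) + y₂) from h)
        rw [Nat.ModEq, Nat.mod_eq_of_lt hy1, Nat.mod_eq_of_lt hy2] at this
        exact this
    have h2 := card_filter_range_mod_le (m := m) (t := t) i
    have h3 : (((Finset.range m).filter (fun c => c % t = i)).card : ℝ) ≤ (m : ℝ) / t + 1 := by
      have : (((m / t + 1 : ℕ)) : ℝ) ≤ (m : ℝ) / t + 1 := by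
        push_cast
        have := Nat.cast_div_le (m := m) (n := t) (α := ℝ)
        linarith
      exact le_trans (by exact_mod_cast h2) this
    exact le_trans (by exact_mod_cast h1) h3
  have hdeg : ∀ i (x : Fin m), (1 - 1 / (100 * (k : ℝ))) * m ≤ ((G i).degree x : ℝ) := by
    intro i x
    -- `univ.filter (x ≠ ·) ⊆ neighborFinset ∪ bad`
    have hsub : (Finset.univ : Finset (Fin m)).filter (fun y => x ≠ y) ⊆
        (G i).neighborFinset x ∪ (Finset.univ : Finset (Fin m)).filter (fun y => x ≠ y ∧ Bad i x y) := by
      intro y hy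
      rw [Finset.mem_filter] at hy
      rw [Finset.mem_union, SimpleGraph.mem_neighborFinset, Finset.mem_filter, hGadj]
      by_cases hb : Bad i x y
      · exact Or.inr ⟨Finset.mem_univ _, hy.2, hb⟩
      · exact Or.inl ⟨hy.2, hb⟩
    have hcardne : ((Finset.univ : Finset (Fin m)).filter (fun y => x ≠ y)).card = m - 1 := by
      rw [Finset.filter_ne, Finset.card_erase_of_mem (Finset.mem_univ _), Finset.card_univ, Fintype.card_fin]
    have h1 := (Finset.card_le_card hsub).trans (Finset.card_union_le _ _)
    rw [hcardne, SimpleGraph.card_neighborFinset_eq_degree] at h1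
    have h1R : ((m : ℝ) - 1) ≤ ((G i).degree x : ℝ) +
        (((Finset.univ : Finset (Fin m)).filter (fun y => x ≠ y ∧ Bad i x y)).card : ℝ) := by
      have : ((m - 1 : ℕ) : ℝ) = (m : ℝ) - 1 := by rw [Nat.cast_sub (by omega)]; norm_num
      rw [← this]; exact_mod_cast h1
    have h2 := hbadcard i x
    -- `m - 1 - (m/t + 1) ≥ (1 - 1/(100k)) m` since `t = 200k` and `m ≥ 400k`
    have hkey : (m : ℝ) / t + 2 ≤ m / (100 * k) := by
      rw [htR, div_add' _ _ _ (by positivity), div_le_div_iff₀ (by positivity) (by positivity)]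
      nlinarith
    have : (1 - 1 / (100 * (k : ℝ))) * m = m - m / (100 * k) := by ring
    rw [this]
    linarith
  -- apply the fact to each class
  have hclass : ∀ i, 0 ≤ ∑ x, ∑ y, (if (G i).Adj x y then V x y else 0) := by
    intro i
    obtain ⟨ω, hω0, hωsupp, hω1⟩ := hM k m hk (G i) (hdeg i)
    -- insert the decomposition
    have hins : ∀ x y, (if (G i).Adj x y then V x y else 0) =
        ∑ S ∈ (Finset.univ : Finset (Fin m)).powersetCard k,
          (if (G i).Adj x y ∧ x ∈ S ∧ y ∈ S then ω S * V x y else 0) := by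
      intro x y
      by_cases hadj : (G i).Adj x y
      · rw [if_pos hadj]
        have : ∀ S ∈ (Finset.univ : Finset (Fin m)).powersetCard k,
            (if (G i).Adj x y ∧ x ∈ S ∧ y ∈ S then ω S * V x y else 0) =
              (if x ∈ S ∧ y ∈ S then ω S else 0) * V x y := by
          intro S _
          by_cases hS : x ∈ S ∧ y ∈ S
          · rw [if_pos ⟨hadj, hS⟩, if_pos hS]
          · rw [if_neg (fun h => hS h.2), if_neg hS, zero_mul]
        rw [Finset.sum_congr rfl this, ← Finset.sum_mul, hω1 x y hadj, one_mul]
      · rw [if_neg hadj]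
        exact (Finset.sum_eq_zero fun S _ => if_neg (fun h => hadj h.1)).symm
    simp_rw [hins]
    have hswap : ∀ x : Fin m, ∑ y, ∑ S ∈ (Finset.univ : Finset (Fin m)).powersetCard k,
        (if (G i).Adj x y ∧ x ∈ S ∧ y ∈ S then ω S * V x y else 0) =
        ∑ S ∈ (Finset.univ : Finset (Fin m)).powersetCard k, ∑ y,
          (if (G i).Adj x y ∧ x ∈ S ∧ y ∈ S then ω S * V x y else 0) := fun x => Finset.sum_comm
    simp_rw [hswap]
    rw [Finset.sum_comm]
    refine Finset.sum_nonneg fun S hS => ?_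
    by_cases hωS : ω S = 0
    · refine le_of_eq (Finset.sum_eq_zero fun x _ => Finset.sum_eq_zero fun y _ => ?_).symm
      split_ifs
      · rw [hωS, zero_mul]
      · rfl
    · -- `S` is a `k`-clique of `G i`: the sum is `ω S · ∑_{x,y ∈ S} V x y ≥ 0`
      have hcl := hωsupp S hωS
      have hSk : S.card = k := hcl.card_eq
      have hadjS : ∀ x ∈ S, ∀ y ∈ S, x ≠ y → (G i).Adj x y := fun x hx y hy hxy =>
        hcl.isClique (Finset.mem_coe.2 hx) (Finset.mem_coe.2 hy) hxy
      have hterm : ∀ x y, (if (G i).Adj x y ∧ x ∈ S ∧ y ∈ S then ω S * V x y else 0) =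
          if x ∈ S ∧ y ∈ S then ω S * V x y else 0 := by
        intro x y
        by_cases hxy : x ∈ S ∧ y ∈ S
        · rw [if_pos hxy]
          by_cases he : x = y
          · subst he
            have h0 : ω S * V x x = 0 := by rw [hV0, mul_zero]
            rw [h0]
            split_ifs <;> rfl
          · rw [if_pos ⟨hadjS x hxy.1 y hxy.2 he, hxy⟩]
        · rw [if_neg hxy, if_neg (fun h => hxy h.2)]
      simp_rw [hterm]
      rw [sum_sum_ite_mem_and S (fun x y => ω S * V x y)]
      have : ∑ x ∈ S, ∑ y ∈ S, ω S * V x y = ω S * ∑ x ∈ S, ∑ y ∈ S, V x y := by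
        rw [Finset.mul_sum]; exact Finset.sum_congr rfl fun x _ => by rw [Finset.mul_sum]
      rw [this]
      exact mul_nonneg (hω0 S) (hvalid S (Finset.mem_powersetCard.2 ⟨Finset.subset_univ _, hSk⟩))
  -- sum over the classes: `∑_i 𝟙[Adj_i x y] = t − 𝟙[0 ≤ V x y]` off the diagonal
  have hcount : ∀ x y : Fin m, x ≠ y →
      ∑ i ∈ Finset.range t, (if (G i).Adj x y then V x y else 0) =
        (t : ℝ) * V x y - (if 0 ≤ V x y then V x y else 0) := by
    intro x y hxy
    by_cases hpos : 0 ≤ V x y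
    · -- exactly the class `col x y % t` is missing
      rw [if_pos hpos]
      have : ∀ i ∈ Finset.range t, (if (G i).Adj x y then V x y else 0) = if i = col x y % t then 0 else V x y := by
        intro i _
        by_cases hi : i = col x y % t
        · rw [if_pos hi, if_neg]
          intro hadj
          exact ((hGadj i x y).1 hadj).2 ⟨hpos, hi.symm⟩
        · rw [if_neg hi, if_pos]
          exact (hGadj i x y).2 ⟨hxy, fun h => hi h.2.symm⟩
      rw [Finset.sum_congr rfl this, Finset.sum_ite, Finset.sum_const_zero, zero_add, Finset.sum_const, nsmul_eq_mul]
      have hmem : col x y % t ∈ Finset.range t := Finset.mem_range.2 (Nat.mod_lt _ ht0)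
      have hcard : ((Finset.range t).filter (fun i => ¬ i = col x y % t)).card = t - 1 := by
        rw [Finset.filter_ne', Finset.card_erase_of_mem hmem, Finset.card_range]
      rw [hcard, Nat.cast_sub (by omega), Nat.cast_one]
      ring
    · rw [if_neg hpos]
      have : ∀ i ∈ Finset.range t, (if (G i).Adj x y then V x y else 0) = V x y := by
        intro i _
        rw [if_pos]
        exact (hGadj i x y).2 ⟨hxy, fun h => hpos h.1⟩
      rw [Finset.sum_congr rfl this, Finset.sum_const, Finset.card_range, nsmul_eq_mul, sub_zero]
  -- the total inequality `t·∑∑V − P ≥ 0`, `P = ∑∑ V⁺`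
  have htotal : 0 ≤ (t : ℝ) * ∑ x, ∑ y, V x y - ∑ x, ∑ y, (if 0 ≤ V x y then V x y else 0) := by
    have h := Finset.sum_nonneg fun i (_ : i ∈ Finset.range t) => hclass i
    rw [Finset.sum_comm] at h
    have h' : ∀ x : Fin m, ∑ i ∈ Finset.range t, ∑ y, (if (G i).Adj x y then V x y else 0) =
        ∑ y, ((t : ℝ) * V x y - (if 0 ≤ V x y then V x y else 0)) := by
      intro x
      rw [Finset.sum_comm]
      refine Finset.sum_congr rfl fun y _ => ?_
      by_cases hxy : x = y
      · subst hxy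
        have hl : ∑ i ∈ Finset.range t, (if (G i).Adj x x then V x x else 0) = 0 :=
          Finset.sum_eq_zero fun i _ => if_neg (fun h => ((hGadj i x x).1 h).1 rfl)
        rw [hl]
        have h0 : V x x = 0 := hV0 x
        simp only [h0, le_refl, if_true, mul_zero, sub_zero]
      · exact hcount x y hxy
    rw [Finset.sum_congr rfl (fun x _ => h' x)] at h
    simp only [Finset.sum_sub_distrib, ← Finset.mul_sum] at h
    exact h
  -- conclude: `|V| = 2V⁺ − V`
  have habs : ∀ x y, |V x y| = 2 * (if 0 ≤ V x y then V x y else 0) - V x y := by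
    intro x y
    split_ifs with h
    · rw [abs_of_nonneg h]; ring
    · rw [abs_of_neg (not_le.1 h)]; ring
  have hsumabs : ∑ x, ∑ y, |V x y| = 2 * ∑ x, ∑ y, (if 0 ≤ V x y then V x y else 0) - ∑ x, ∑ y, V x y := by
    simp_rw [habs]
    simp only [Finset.sum_sub_distrib, ← Finset.mul_sum]
  rw [hsumabs]
  -- `2P − S ≤ 2tS − S = (2t−1)S` with `P ≤ tS`
  have ht' : (2 : ℝ) * t - 1 = 400 * k - 1 := by rw [htR]; ring
  rw [← ht']
  linarith

/-- **The ℓ₁-constant is `O(k)`, conditionally on Montgomery's theorem (edge form).** Assume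
`MontgomeryFractionalCliqueDecomposition`. For `4 ≤ k`, `400k ≤ m` and every `k`-clique-non-negative edge weighting `w` of
`K_m`: `∑_e |w(e)| ≤ (400k − 1)·∑_e w(e)`. [new] -/
theorem abs_sum_le_linear_of_montgomery (hM : MontgomeryFractionalCliqueDecomposition) {k : ℕ} (hk : 4 ≤ k)
    (hm : 400 * k ≤ m) (w : Edge m → ℝ)
    (hw : ∀ Q ∈ (Finset.univ : Finset (Fin m)).powersetCard k, 0 ≤ softWindow w Q) :
    ∑ e, |w e| ≤ (400 * (k : ℝ) - 1) * ∑ e, w e := by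
  classical
  obtain ⟨V, hVdef⟩ : ∃ V : Fin m → Fin m → ℝ,
      V = fun x y => if h : x = y then 0 else w ⟨s(x, y), CliqueExtLowerBound.Negative.mk_mem_edgeSet_top h⟩ := ⟨_, rfl⟩
  have hV0 : ∀ x, V x x = 0 := fun x => by rw [hVdef]; simp
  have hVoff : ∀ (x y : Fin m) (h : x ≠ y), V x y = w ⟨s(x, y), CliqueExtLowerBound.Negative.mk_mem_edgeSet_top h⟩ :=
    fun x y h => by rw [hVdef]; simp [h]
  have hVsym : ∀ x y, V x y = V y x := by
    intro x y
    by_cases h : x = y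
    · rw [h]
    · rw [hVoff x y h, hVoff y x (Ne.symm h)]
      congr 1
      exact Subtype.ext Sym2.eq_swap
  have hvalidM : ∀ Q ∈ (Finset.univ : Finset (Fin m)).powersetCard k, 0 ≤ ∑ x ∈ Q, ∑ y ∈ Q, V x y := by
    intro Q hQ
    have h := hw Q hQ
    rw [softWindow_eq_half_sum_sum w V hV0 hVoff Q] at h
    linarith
  have hmass : ∑ e, w e = (∑ x, ∑ y, V x y) / 2 := sum_edge_eq_half_sum_sum w V hV0 hVoff
  have habsmass : ∑ e, |w e| = (∑ x, ∑ y, |V x y|) / 2 :=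
    sum_edge_eq_half_sum_sum (fun e => |w e|) (fun x y => |V x y|) (fun x => by rw [hV0, abs_zero])
      (fun x y h => by rw [hVoff x y h])
  rw [hmass, habsmass]
  have := sum_sum_abs_le_of_montgomery hM hk hm V hVsym hV0 hvalidM
  rw [mul_div_assoc']
  exact div_le_div_of_nonneg_right this (by norm_num)

/-- **The ℓ₁-constant is `O(k)`, conditionally on Montgomery's theorem** (registered form of
`abs_sum_le_linear_of_montgomery`). [new] -/
theorem l1_constant_le_of_montgomery : MontgomeryFractionalCliqueDecomposition → ∀ {m k : ℕ}, 4 ≤ k → 400 * k ≤ m → ∀ (w : Edge m → ℝ), (∀ Q ∈ (Finset.univ : Finset (Fin m)).powersetCard k, 0 ≤ softWindow w Q) → ∑ e, |w e| ≤ (400 * (k : ℝ) - 1) * ∑ e, w e :=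
  fun hM _ _ hk hm w hw => abs_sum_le_linear_of_montgomery hM hk hm w hw

end

end Summit.PneNP.PneNP.Theorems
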